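import Summits.BirchSwinnertonDyer.Rank1Residual.GaloisImage.KuriharaRecordBSDpThreeLevelTwoEnd
import Literature.NumberTheory.GaloisCohomology.PoitouTateSelmerStructures
import HarnessLib

/-!
# R1-61, part 2: the END-m2 record corollaries with the Poitou–Tate family taken from the NAMED FACT
# `poitouTate_selmerStructure_duality ℚ` — the "WHAT A RECORD COSTS" form on class A2:
# named facts + port + row + values
# (cell `b2b-bsdres`, team n1011, ROUTE-1 §33.3 / §36 R1-61; OWNERS row T-E2-REC; seat p18)

HONEST FRAMING (cell `b2b-bsdres`, run/shared/lean/b2b/bsd-rank1-residual/, verbatim in every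
file): the goal of the cell is to DELETE the COMBINATION-SHAPED residual classes of the
Birch–Swinnerton-Dyer formula for ALL analytic-rank `≤ 1` elliptic curves over `ℚ` — "full BSD
formula for every rank `≤ 1` curve in class `C`" assembled STRICTLY from published theorems — so
that the rank-`≤ 1` remainder becomes exactly the CONSTRUCTION-SHAPED classes, which are TYPED
(missing-input `Prop`s), NOT attempted. This is not "finishing BSD". Team n1011 (N10/N11, the
additive block `X4 ∧ p = 3`): research route; PER-PAIR record shape, NOT a class theorem; TOOL
theorems only (no definition, no named fact minted); nothing booked; no mark / label moved.  END-m2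
is DEBT REDUCTION on class A2 (`BSD(E,3)` only where `ord₃(L(E,1)/Ω_E) ≤ 2`), not coverage:
CONDITIONAL on the UPPER-half facts of the X4 chain of record (`hKatoS hDel hmodD hKatoχ`; `hGZK hmod
h26`), Cassels–Tate (`hCT`), the Poitou–Tate duality of Selmer structures as the NAMED FACT `hPT`
(Milne ADT I.4.10 / Howard 2.1.11 — replacing the family `inv hperf hsum hcompl` of part 1), Tate's
`hEP`, and the ONE port `KatoKuriharaPortThreeAt W 1 v₃` (FLAG `K22-Thm3.13-PORT@3`,
construction-shaped, NOT in print at `3`); NO [S24] fact of any level.  The certificate lines are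
per-record EVIDENCE; the `3`-adic tower is a visible input of every END-m2 record.

## What and why (r1 ROUTE-1 §36 R1-61; lead R5-70 ADDENDUM 1 (d); the `m = 1` pattern is
## `KuriharaRecordBSDpThreeLevelOneEndOfFacts`, p294284)

`KuriharaRecordBSDpThreeLevelTwoEnd` (part 1) carries the Poitou–Tate family at `3` as four binders
`inv hperf hsum hcompl`; the tree's NAMED FACT `poitouTate_selmerStructure_duality ℚ` supplies such a
family at every modulus.  This file is the twin with those binders replaced by the ONE fact `hPT`:

* `Assembly.bsdp_three_of_towerSurj_of_levelTwoCertificates_of_facts` (potentially good, unit),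
* `Assembly.bsdp_three_potMult_of_levelTwoCertificates_of_facts` ((M) rows),

so that an END-m2 record reads: NAMED FACTS {hKatoS hDel hGZK hmod hmodD hKatoχ h26 hCT hPT hEP} +
PORT {hPort at `t = 1`} + ROW {hI hΔ hc₄, tower (+ `ord₃ j < 0` on (M)), ht1, hr, htam / hc3,
N ≤ 130000, D, hopt} + CERTIFICATE {n ∈ 𝒩₃, hcyc, ψ onto ℤ/9} + VALUES {`3·δ̃_n ≠ 0`, `3·δ̃_1 = 0`
in ℤ/9; ψ₂₇, `δ̃_1 ≠ 0` in ℤ/27} — nothing else.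

References: C.-H. Kim, AJM 148 (2026) Thm. 1.9 (6), Thm. 3.13 [Kim2022StructureSelmer]; K. Rubin,
PCMI 18 (2011) Thm. 2.8.4, Cor. 2.8.9 [Rubin2011]; J. S. Milne, *Arithmetic Duality Theorems* (2006)
I Thm. 4.10 [MilneADT2006]; B. Howard, Compositio 140 (2004) Thm. 2.1.11 [Howard2004HeegnerKolyvagin];
K. Kato, Astérisque 295 (2004) Thm. 14.5 (3) [Kato2004Asterisque]; A. Agashe, K. Ribet, W. Stein
(2006) Thm. 2.6 [AgasheRibetStein2006]; J. H. Silverman, AEC (2009) X.4.2, X.4.14 [SilvermanAEC2009].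
-/

noncomputable section

open scoped Classical NumberField ContRepresentation
open Function Field NumberField IsDedekindDomain IsDedekindDomain.HeightOneSpectrum WeierstrassCurve
  CongruenceSubgroup
  Literature.NumberTheory.EllipticCurves Literature.NumberTheory.EllipticCurves.ModularForms
  Literature.NumberTheory.EllipticCurves.Rank1Residual
  Literature.NumberTheory.EllipticCurves.AgasheRibetStein2006
  Literature.NumberTheory.GaloisRepresentations
  Literature.NumberTheory.GaloisRepresentations.DiscreteGaloisModule Literature.NumberTheory.GaloisCohomology
  Rat.HeightOneSpectrum
  Summit.BirchSwinnertonDyer.Rank1Residual.Additive Summit.BirchSwinnertonDyer.Rank1Residual.X4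
open Literature.NumberTheory.DiophantineGeometry.Dioph (ratModP)

namespace Summit.BirchSwinnertonDyer.Rank1Residual.GaloisImage.Assembly

/-! ### The END-m2 record corollaries over the named Poitou–Tate fact -/

/-- **END-m2, RECORD COROLLARY (r1 ROUTE-1 §36 R1-61): `BSD(E,3)` on a class-A2 row from ONE
depth-one Kurihara non-vanishing and two level-zero fields — NAMED-FACTS form** (`hPT` in place of
the Poitou–Tate family).  `W/ℚ` globally minimal with integral model `E₀` ADDITIVE at `3` (`3 ∣ Δ`,
`3 ∣ c₄`), the `3`-adic tower (both halves), `#E(ℚ₃)[3] = 3`, analytic rank `0`, `3 ∤ ∏ c_ℓ`, an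
OPTIMAL datum at `N ≤ 130000`; the UPPER-half facts of the X4 chain of record; NO [S24] fact;
Cassels–Tate; `hPT`; Tate's `hEP`; ONE port `KatoKuriharaPortThreeAt W 1 v₃`; and the CERTIFICATE:
ONE `n ∈ 𝒩₃(E,3)` with the cyclicity flag at its primes, `ψ` onto `ℤ/9`, `3 · δ̃_n(ψ) ≠ 0` and
`3 · δ̃_1 = 0` in `ℤ/9`, `δ̃_1 ≢ 0 (mod 27)`.  THEN `BSD(E, 3)` — part 1's
`bsdp_three_of_towerSurj_of_levelTwoCertificates_of_baseRigidity` with the family unpacked from `hPT 3`.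
[cite: Kim2022StructureSelmer, Thm. 1.9 (6) and Thm. 3.13] [cite: Rubin2011, Thm. 2.8.4 and Cor. 2.8.9]
[cite: MilneADT2006, Ch. I, Thm. 4.10] [cite: Kato2004Asterisque, Thm. 14.5 (3) (p. 236)]
[cite: AgasheRibetStein2006, Thm. 2.6 (p. 619)] [cite: SilvermanAEC2009, Thm. X.4.2 (a) and X.4.14] -/
theorem bsdp_three_of_towerSurj_of_levelTwoCertificates_of_facts
    (hKatoS : Kato2004.rankZero_padicValNat_sha_le_sub_localTamagawa_of_additive_potGood_of_imageContainsSL2)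
    (hDel : Delbourgo1998.prop4_rankZero_pow_dvd_constantCoeff)
    (hGZK : rank_eq_analyticRank_of_analyticRank_le_one) (hmod : hasEntireLFunction_rat)
    (hmodD : nonempty_modularParametrizationData)
    (hKatoχ : Wuthrich2014.kato_halfEigenCharIdeal_dvd_cyclotomicPrime_of_surjective)
    (h26 : cremona_abs_maninConstant_eq_one_of_level_le)
    (hCT : exists_casselsTate_pairing (K := ℚ))
    (W : WeierstrassCurve ℚ) [W.IsElliptic] [W.IsGloballyMinimal]
    -- the row
    {E₀ : WeierstrassCurve ℤ} (hI : integralModelInt W = E₀)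
    (hΔ : (3 : ℤ) ∣ E₀.Δ) (hc₄ : (3 : ℤ) ∣ E₀.c₄)
    (htower : ∀ m : ℕ, W.HasSurjectiveModNGaloisRep (3 ^ m : ℕ))
    (ht1 : Nat.card {Q : (W.baseChange ℚ_[3]).toAffine.Point // (3 : ℕ) • Q = 0} = 3 ^ 1)
    (hr : W.analyticRank = 0) (htam : ¬ 3 ∣ W.tamagawaProduct)
    {N : ℕ} [NeZero N] (hN : N ≤ 130000) (D : ModularParametrizationData W N)
    (hopt : ∀ z ∈ D.L.lattice, ∃ w ∈ periodLattice D.f, z = D.c * w)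
    -- the Poitou–Tate fact, Tate's local Euler characteristic, ONE port
    (hPT : poitouTate_selmerStructure_duality ℚ)
    (hEP : ∀ v : HeightOneSpectrum (𝓞 ℚ), localEulerPoincareCharacteristic (v.adicCompletion ℚ))
    (v₃ : HeightOneSpectrum (𝓞 ℚ)) (hv₃ : ((3 : ℕ) : 𝓞 ℚ) ∈ v₃.asIdeal)
    (hPort : KatoKuriharaPortThreeAt W 1 v₃)
    -- the certificate: ONE depth-one non-vanishing, two level-zero fields
    (n : ℕ) [NeZero n] (hn : Kato.IsKolyvaginProduct W 3 3 n)
    (hcyc : ∀ (ℓ : ℕ) [Fact ℓ.Prime], ℓ ∣ n →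
      Nat.card {P : ((integralModelInt W).map (Int.castRingHom (ZMod ℓ))).toAffine.Point //
        3 • P = 0} ≤ 3)
    (ψ : (ℓ : ℕ) → (ZMod ℓ)ˣ →* Multiplicative (ZMod (3 ^ 2)))
    (hψ : ∀ ℓ ∈ n.primeFactors, Function.Surjective (ψ ℓ))
    (hcert : (3 : ZMod (3 ^ 2)) * kuriharaNumber D.f (3 ^ 2) n ψ ≠ 0)
    (hzero₉ : (3 : ZMod (3 ^ 2)) * kuriharaNumber D.f (3 ^ 2) 1 ψ = 0)
    (ψ₂₇ : (ℓ : ℕ) → (ZMod ℓ)ˣ →* Multiplicative (ZMod (3 ^ 3)))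
    (hunit₁ : kuriharaNumber D.f (3 ^ 3) 1 ψ₂₇ ≠ 0) :
    BSDp W 3 := by
  obtain ⟨inv, hperf, hsum, -, hcompl⟩ := hPT 3
  exact bsdp_three_of_towerSurj_of_levelTwoCertificates_of_baseRigidity hKatoS hDel hGZK hmod hmodD
    hKatoχ h26 hCT W hI hΔ hc₄ htower ht1 hr htam hN D hopt inv hperf hsum hcompl hEP v₃ hv₃ hPort n hn
    hcyc ψ hψ hcert hzero₉ ψ₂₇ hunit₁

/-- **END-m2, RECORD COROLLARY on the potentially MULTIPLICATIVE class-A2 rows (`ord₃ j < 0`) —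
NAMED-FACTS form.**  As `bsdp_three_of_towerSurj_of_levelTwoCertificates_of_facts` with the UPPER
half through additive-p1's `ω`-branch socket (no Tamagawa hypothesis beyond `3 ∤ c₃`, no Manin bound
on the UPPER side); the tower stays a binder for the LOWER datum; `hPT` unpacked at `3`.
[cite: Kim2022StructureSelmer, Thm. 1.9 (6) and Thm. 3.13] [cite: Rubin2011, Thm. 2.8.4 and Cor. 2.8.9]
[cite: MilneADT2006, Ch. I, Thm. 4.10] [cite: Delbourgo1998, Prop. 4 (p. 144)]
[cite: AgasheRibetStein2006, Thm. 2.6 (p. 619)] [cite: SilvermanAEC2009, Thm. X.4.2 (a) and X.4.14] -/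
theorem bsdp_three_potMult_of_levelTwoCertificates_of_facts
    (hKatoS : Kato2004.rankZero_padicValNat_sha_le_sub_localTamagawa_of_additive_potGood_of_imageContainsSL2)
    (hDel : Delbourgo1998.prop4_rankZero_pow_dvd_constantCoeff)
    (hGZK : rank_eq_analyticRank_of_analyticRank_le_one) (hmod : hasEntireLFunction_rat)
    (hmodD : nonempty_modularParametrizationData)
    (hKatoχ : Wuthrich2014.kato_halfEigenCharIdeal_dvd_cyclotomicPrime_of_surjective)
    (h26 : cremona_abs_maninConstant_eq_one_of_level_le)
    (hCT : exists_casselsTate_pairing (K := ℚ))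
    (W : WeierstrassCurve ℚ) [W.IsElliptic] [W.IsGloballyMinimal]
    {E₀ : WeierstrassCurve ℤ} (hI : integralModelInt W = E₀)
    (hΔ : (3 : ℤ) ∣ E₀.Δ) (hc₄ : (3 : ℤ) ∣ E₀.c₄)
    (htower : ∀ m : ℕ, W.HasSurjectiveModNGaloisRep (3 ^ m : ℕ)) (hjneg : padicValRat 3 W.j < 0)
    (hc3 : ¬ 3 ∣ (W.baseChange ℚ_[3]).localTamagawaNumber ℤ_[3])
    (ht1 : Nat.card {Q : (W.baseChange ℚ_[3]).toAffine.Point // (3 : ℕ) • Q = 0} = 3 ^ 1)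
    (hr : W.analyticRank = 0)
    {N : ℕ} [NeZero N] (hN : N ≤ 130000) (D : ModularParametrizationData W N)
    (hopt : ∀ z ∈ D.L.lattice, ∃ w ∈ periodLattice D.f, z = D.c * w)
    (hPT : poitouTate_selmerStructure_duality ℚ)
    (hEP : ∀ v : HeightOneSpectrum (𝓞 ℚ), localEulerPoincareCharacteristic (v.adicCompletion ℚ))
    (v₃ : HeightOneSpectrum (𝓞 ℚ)) (hv₃ : ((3 : ℕ) : 𝓞 ℚ) ∈ v₃.asIdeal)
    (hPort : KatoKuriharaPortThreeAt W 1 v₃)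
    (n : ℕ) [NeZero n] (hn : Kato.IsKolyvaginProduct W 3 3 n)
    (hcyc : ∀ (ℓ : ℕ) [Fact ℓ.Prime], ℓ ∣ n →
      Nat.card {P : ((integralModelInt W).map (Int.castRingHom (ZMod ℓ))).toAffine.Point //
        3 • P = 0} ≤ 3)
    (ψ : (ℓ : ℕ) → (ZMod ℓ)ˣ →* Multiplicative (ZMod (3 ^ 2)))
    (hψ : ∀ ℓ ∈ n.primeFactors, Function.Surjective (ψ ℓ))
    (hcert : (3 : ZMod (3 ^ 2)) * kuriharaNumber D.f (3 ^ 2) n ψ ≠ 0)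
    (hzero₉ : (3 : ZMod (3 ^ 2)) * kuriharaNumber D.f (3 ^ 2) 1 ψ = 0)
    (ψ₂₇ : (ℓ : ℕ) → (ZMod ℓ)ˣ →* Multiplicative (ZMod (3 ^ 3)))
    (hunit₁ : kuriharaNumber D.f (3 ^ 3) 1 ψ₂₇ ≠ 0) :
    BSDp W 3 := by
  obtain ⟨inv, hperf, hsum, -, hcompl⟩ := hPT 3
  exact bsdp_three_potMult_of_levelTwoCertificates_of_baseRigidity hKatoS hDel hGZK hmod hmodD hKatoχ
    h26 hCT W hI hΔ hc₄ htower hjneg hc3 ht1 hr hN D hopt inv hperf hsum hcompl hEP v₃ hv₃ hPort n hn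
    hcyc ψ hψ hcert hzero₉ ψ₂₇ hunit₁

end Summit.BirchSwinnertonDyer.Rank1Residual.GaloisImage.Assembly

end
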